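import Summits.QuantumFields.BalabanUV.T4Continuum.Support.ShellMeasureWilsonExteriorSUN
import Summits.QuantumFields.BalabanUV.T4Continuum.Support.ShellMeasureRootCompositionPushCubes
import Summits.QuantumFields.BalabanUV.T4Continuum.Support.ShellMeasureWilsonStraddle

/-!
# `T4Continuum.ShellMeasureWilsonLedgerSUN` — END-I's ONE-RUN LEVEL-0 LEDGER of the FULL `SU(N)` GIBBS MEASURE, EVERY
# `N`: (M1)₀ WITHOUT bond window, WITHOUT co-tests, WITHOUT mass ratio, fed slot by slot into row S17's cube-partition
# push — displayed binders left: per-cube two-run closeness + numerics; row S19 `ShellMeasureWilsonLedger` at `G := SU(N)`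
# (cell `pub-balaban`, sub-cell `t4`, spine estimate NE7c (node U5b); NE7c ROUND-2 crew `t4-ne7c-formalise-*`, unit
# `b2b-balaban-t4-ne7c-formalise-leaf-06` gen 3 (the S19 lineage), OFFER «S19 FOR SU(N)» (journal; the owner
# t4-ne7c-p1 books / renumbers / refuses); c5-OPTIONAL SU(N) orbit — SU(2) is the row's certified instance; ADDITIVE —
# imports this lineage's `ShellMeasureWilsonExteriorSUN` (file 1 of the offer), row S17's
# `ShellMeasureRootCompositionPushCubes` (p208728) and row S2's `ShellMeasureWilsonStraddle` (p208215) only; 0 `def`,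
# 0 sorry, 0 cite tags)

HONEST FRAMING.  Finite four-torus programme, rung (B)+1 only — NOT infinite volume, NOT a mass gap, NOT the Clay
problem, NOT summit progress.  NE7c = `T4IndicatorShell.ShellWeightBound` is NOT PRINTED in [Balaban 1983–89] and NOT
PROVED; «NE7c ⇐ the named binders» (trigger c3); a ONE-run level-0 ledger is NOT NE7c (two runs, live window, rate —
untouched here); (M1)₀ realized ≠ NE7c; SU(2) is the certified instance (c5).  (M1) for Bałaban's inductively defined
effective measures at live levels is NOT PRINTED (GAPS G-ne7cp1-1) and asserted by nobody.  WHAT THIS FILE DOES: row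
S19's two steps at `G := SU(N)`, token for token under `SU2 ↦ SUN N`, `expFibreChart ↦ expFibreChartSU`, row S1's
constant `2(n + β·#P_w·8S(8+32S))/(1−δ)` ↦ row S34's `2(#Λ·d_N + β·#P_w·4S(8+16S))/(1−δ)` and the END-II currency of
(SM)₀ (`36(e^{4S·Rad} − 1)/(Rad−1)² ≤ δθ`, free `Rad > 1`).  Under row S17's reading — the pieces of a level-0 slot are
pushed AFTER the partition of unity of the OTHER cubes is summed (`ShellMeasureRootCompositionPushCubes.sum_regionDensity_mem`)
— the realized measure of EVERY level-0 slot is the FULL positive integral, the Gibbs law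
`e^{−β Σ_{all p}(1 − reTr U(∂p))} dU` on `SU(N)^{bonds}`, with NO co-test and NO bond window; END-I's level-0 wall `hac`
is then (M1)₀ for that un-windowed law, which FOLLOWS from the tree: file 1's exterior form of leaf-10's gauge-invariant
face (`ShellMeasureWilsonExteriorSUN.slotAntiConcentration_wilson_suN_gaugeInvariant_exterior`, the Wilson plaquettes
avoiding the chart block riding as a blind factor) gives (M1)₀ for `e^{−β Σ_{P_ext}} · 1[box σ-small] · e^{−β Σ_{P_w}} dU`,
and when the slot's classifier set IS its box (B14 (2.17) TYPE: `sup_{p ⊂ □∼}`, the box = `□∼`) and `θ ≤ σ`, the box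
test equals `1` on the threshold shell, so `ShellMeasureWilsonStraddle.slotAntiConcentration_withDensity_of_le_on_shell`
removes it with the SAME constant — no mass ratio, no (MR)₀ binder at level 0, for every `N`.  Nothing printed is
asserted; every declaration is [folklore] composition of tree theorems BY NAME.  HONEST DEPENDENCY (cell): continuum YM
on T⁴ ⇐ BetaPertH ∧ nine spine estimates (0/9 proved); BetaPertH ⇐ (D1) ∧ (D4) ∧ CAP+tail; G-an2-4 gates asym, D1 and NE2/3/4.

## What is proved (all [folklore])

* §0 `wilsonWeight_mul_eq_union` (any gauge group: merging Wilson weights over disjoint plaquette sets),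
  `wilsonU_lt_iff` (row S34's `SU(N)` classifier below `θ` iff every classifier plaquette is `θ`-small).
* §1 `slotAntiConcentration_wilson_suN_gibbs` — (M1)₀ for the UN-WINDOWED, UN-CO-TESTED law
  `(fieldMeasure P j SU(N)).withDensity (e^{−β Σ_{p∈P_ext ∪ P_w}(1 − reTr U(∂p))})` and the classifier
  `wilsonU P_u = max_{p ∈ P_u} dist1 U(∂p)` with `boxPlaqs ⊆ P_u ⊆ boxPlaqs`, constant row S34's
  `2(#Λ·d_N + β·#P_w·4S(8+16S))/(1−δ)`, under file 1's geometry/numerics (non-wrapping box of side `≤ m`, chart bonds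
  `Λ` = box bonds off the axial comb, window `0 ≤ S ≤ 1/4`, reach `N(d−1)mσ < 4` and `√N(π/2)(d−1)mσ ≤ S`, `β ≥ 0`,
  `0 < θ`, `0 ≤ δ < 1`, `0 ≤ ρ ≤ (1−δ)/2`, `Rad > 1`, (SM)₀, (SM)_σ) plus `θ ≤ σ`, `P_ext` avoiding `Λ` and disjoint from
  `P_w`; `…_gibbs_of_union` — the same for any plaquette set `P_all = P_ext ∪ P_w` (e.g. ALL plaquettes of the torus).
* §2 `levelLedger_wilson_suN_levelZero` — row S17's `levelLedger_levelZero_cubes` for a finite family of cubes `C K`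
  on ONE lattice `(P, j)`, realized measure of every slot THE SAME `SU(N)` Gibbs law `e^{−β Σ_{P_all}} dU`, tested
  variables `u^A K t s = wilsonU (box s)`, per-slot (M1)₀ from §1 raised to a uniform `D₀` by
  `T4ShellMeasureFibre.slotAntiConcentration_mono`.  DISPLAYED binders left: the other run's measurable tested
  variables `u^B` and the per-cube a.e. closeness `|u^A_s − u^B_s| ≤ ρ₀θ₀` (node U1b at level 0), the numerics, and
  `D_s ≤ D₀` — NO (M1) binder, NO window, NO co-test, NO mass ratio.

NON-VACUITY OF THE NUMERIC BINDERS.  The hypothesis list of §1 (leaf-10's numerics + `θ ≤ σ`) is jointly satisfiable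
for every `N`, `d`, `m`: leaf-10's `ShellMeasureRegimeWitnessSUN.levelZero_regime_exists` (p218650) exhibits a witness
with `θ = σ` (not imported; arithmetic only — measure-level non-vacuity is the toys' business).

WHAT THIS DOES NOT DO.  One lattice, constant in `K` and `t` (the source insertion is file 3
`ShellMeasureWilsonLedgerSUNSource`, the `K`-indexed lattice family row S19 f3's bookkeeping pointwise in `K`, not
written); the slot COUNT is (W1)/row S9's; no live level, no rate; nothing of the countdown; SU(2) stays the certified
instance (its face of record is row S19, gnomonic cube chart — this file is NOT its `N = 2` instance); NE7c NOT proved;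
0/9 spine.
-/

noncomputable section

open Set Function MeasureTheory Finset

namespace Summit.QuantumFields.BalabanUV.T4Continuum.ShellMeasureWilsonLedgerSUN

open scoped ENNReal
open Literature.MathematicalPhysics.QuantumFieldTheory.Balaban1983to89
open T4ShellMeasure (SlotAntiConcentration)
open T4ShellMeasureLevels (LevelLedger)
open ShellMeasureExpChartSUN (SUN dimSU)
open T4AxialGaugeFixing (combBonds)
open T4AxialGaugeSmallField (boxPlaqs boxBonds)
open ShellMeasureWilsonRealizedSUN (wilsonU measurable_wilsonU wilsonSum_nonneg)
open ShellMeasureWilsonGaugeInvariantSUN (boxTest giF measurable_giF)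
open ShellMeasureWilsonStraddle (slotAntiConcentration_withDensity_of_le_on_shell plaqSmallOn_mono_threshold
  plaqSmallOn_anti)
open ShellMeasureWilsonExteriorSUN (exteriorWilson_admissible slotAntiConcentration_wilson_suN_gaugeInvariant_exteriorWilson)
open ShellMeasureRootCompositionPushCubes (regionWeight regionShell regionPiece levelLedger_levelZero_cubes)

variable {N : ℕ} [NeZero N] {P : Params} {j : ℕ}

/-! ## §0 Two bookkeeping identities -/

/-- merging two Wilson weights over disjoint plaquette sets (any gauge group; the `SU(2)`-typed twin is
`ShellMeasureWilsonLevelZero.wilsonWeight_mul_eq_union`). [folklore] -/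
theorem wilsonWeight_mul_eq_union {G : Type*} [GaugeGroup G] [DecidableEq (Plaq P j)] {Pe Pw : Finset (Plaq P j)}
    (h : Disjoint Pe Pw) (β : ℝ)
    (U : GaugeField P j G) :
    ENNReal.ofReal (Real.exp (-(β * ∑ p ∈ Pe, (1 - reTr (GaugeField.plaqHol U p))))) *
        ENNReal.ofReal (Real.exp (-(β * ∑ p ∈ Pw, (1 - reTr (GaugeField.plaqHol U p))))) =
      ENNReal.ofReal (Real.exp (-(β * ∑ p ∈ Pe ∪ Pw, (1 - reTr (GaugeField.plaqHol U p))))) := by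
  rw [← ENNReal.ofReal_mul (Real.exp_pos _).le, ← Real.exp_add, Finset.sum_union h]
  congr 2
  ring

/-- row S34's `SU(N)` classifier is below `θ` iff every classifier plaquette is `θ`-small (the `SU(2)` twin is
`ShellMeasureWilsonStraddle.wilsonU_lt_iff`). [folklore] -/
theorem wilsonU_lt_iff {Pu : Finset (Plaq P j)} (hPu : Pu.Nonempty) {θ : ℝ} {U : GaugeField P j (SUN N)} :
    wilsonU hPu U < θ ↔ ∀ p ∈ Pu, dist1 (GaugeField.plaqHol U p) < θ := by
  unfold wilsonU
  exact Finset.sup'_lt_iff hPu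

variable [DecidableEq (PBond P j)]

/-! ## §1 (M1)₀ for the un-windowed, un-co-tested level-0 `SU(N)` Gibbs law -/

section Gibbs

variable [DecidableEq (Plaq P j)]

/-- **(M1)₀ FOR THE FULL LEVEL-0 `SU(N)` GIBBS LAW — NO WINDOW, NO CO-TESTS, NO MASS RATIO, EVERY `N`.**  File 1's data:
a non-wrapping box `[lo, hi]` of side `≤ m`, chart bonds `Λ` (box bonds off the axial comb, the comb covering the rest of
the box), window `0 ≤ S ≤ 1/4`, co-test threshold `σ > 0` with the `SU(N)` reach conditions `N·(d−1)·m·σ < 4`,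
`√N·(π/2)·(d−1)·m·σ ≤ S`, weight plaquettes `P_w`, `β ≥ 0`, `θ > 0`, `0 ≤ δ < 1`, `0 ≤ ρ ≤ (1−δ)/2`, a free radius
`Rad > 1` with (SM)₀ `36(e^{4S·Rad} − 1)/(Rad−1)² ≤ δθ`, (SM)_σ `4(4S)²e^{8S} ≤ δσ`; PLUS: the slot's classifier plaquettes
`P_u` (nonempty, inside the box) COVER the box (`boxPlaqs lo hi ⊆ P_u`, B14 (2.17) TYPE: the box is `□∼` itself),
`θ ≤ σ`, and exterior Wilson plaquettes `P_ext` AVOIDING `Λ`, disjoint from `P_w`.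
CONCLUSION: `SlotAntiConcentration ((fieldMeasure P j SU(N)).withDensity (e^{−β Σ_{p∈P_ext ∪ P_w}(1 − reTr U(∂p))}))
(wilsonU P_u) θ ρ (2(#Λ·d_N + β·#P_w·4S(8+16S))/(1−δ))`.  Proof: file 1's
`slotAntiConcentration_wilson_suN_gaugeInvariant_exterior` with the blind factor `G = e^{−β Σ_{P_ext}}`, then the box
test is removed by `slotAntiConcentration_withDensity_of_le_on_shell` — on the shell `wilsonU < θ ≤ σ` forces
`box σ-small`.  (M1)₀ realized ≠ NE7c. [folklore] -/
theorem slotAntiConcentration_wilson_suN_gibbs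
    {lo hi : Fin P.d → ℤ} {m : ℕ} (hN : ∀ κ, hi κ - lo κ < P.sitesPerDir j) (hm : ∀ κ, hi κ ≤ lo κ + m)
    (Λ : Finset (PBond P j)) (hΛbox : ∀ b ∈ Λ, b ∈ boxBonds lo hi)
    (hΛcomb : Disjoint Λ (combBonds lo hi))
    (hcov : ∀ b ∈ boxBonds lo hi, b ∉ Λ → b ∈ (combBonds lo hi : Finset (PBond P j)))
    {S σ : ℝ} (hS : 0 ≤ S) (hS4 : S ≤ 1 / 4) (hσ : 0 < σ)
    (hN4 : (N : ℝ) * (((P.d - 1 : ℕ) : ℝ) * m * σ) < 4)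
    (hrad : Real.sqrt N * (Real.pi / 2 * (((P.d - 1 : ℕ) : ℝ) * m * σ)) ≤ S)
    {Pu : Finset (Plaq P j)} (hPu : Pu.Nonempty) (hPubox : ∀ p ∈ Pu, p ∈ boxPlaqs lo hi)
    (hboxPu : boxPlaqs lo hi ⊆ (↑Pu : Set (Plaq P j)))
    (Pw Pext : Finset (Plaq P j)) {β θ δ ρ Rad : ℝ} (hβ : 0 ≤ β) (hθ : 0 < θ) (hθσ : θ ≤ σ) (hδ0 : 0 ≤ δ)
    (hδ1 : δ < 1) (hρ0 : 0 ≤ ρ) (hρ : ρ ≤ (1 - δ) / 2) (hRad : 1 < Rad)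
    (hSM : 36 * (Real.exp (4 * S * Rad) - 1) / (Rad - 1) ^ 2 ≤ δ * θ)
    (hSMσ : 4 * (4 * S) ^ 2 * Real.exp (2 * (4 * S)) ≤ δ * σ)
    (hPext : ∀ p ∈ Pext, (⟨p.src, p.μ⟩ : PBond P j) ∉ Λ ∧ (⟨p.src.shift p.μ, p.ν⟩ : PBond P j) ∉ Λ ∧
      (⟨p.src.shift p.ν, p.μ⟩ : PBond P j) ∉ Λ ∧ (⟨p.src, p.ν⟩ : PBond P j) ∉ Λ)
    (hdisj : Disjoint Pext Pw) :
    SlotAntiConcentration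
      ((fieldMeasure P j (SUN N)).withDensity fun U =>
        ENNReal.ofReal (Real.exp (-(β * ∑ p ∈ Pext ∪ Pw, (1 - reTr (GaugeField.plaqHol U p))))))
      (wilsonU hPu) θ ρ
      (2 * (((Λ.card * dimSU N : ℕ) : ℝ) + β * ∑ _p ∈ Pw, (4 * S) * (8 + 4 * (4 * S))) / (1 - δ)) := by
  -- the blind exterior Wilson factor `G = e^{−β Σ_{P_ext}}` is admissible (file 1 §1)
  obtain ⟨hGm, -, -, -⟩ := exteriorWilson_admissible (N := N) Λ hPext hβ
  -- (M1)₀ for the box-tested law with the blind factor (file 1's exterior form of the gauge-invariant face)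
  have h' := slotAntiConcentration_wilson_suN_gaugeInvariant_exteriorWilson hN hm Λ hΛbox hΛcomb hcov hS hS4 hσ hN4
    hrad hPu hPubox Pw Pext hβ hθ hδ0 hδ1 hρ0 hρ hRad hSM hSMσ hPext
  -- remove the box test on the shell
  refine slotAntiConcentration_withDensity_of_le_on_shell (fieldMeasure P j (SUN N))
    (hGm.mul (measurable_giF lo hi σ β Pw)) h' (fun U => ?_) (fun U _ hUθ => ?_)
  · -- `G · giF ≤ e^{−β Σ_{P_ext ∪ P_w}}` everywhere
    show ENNReal.ofReal (Real.exp (-(β * ∑ p ∈ Pext, (1 - reTr (GaugeField.plaqHol U p))))) *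
        giF lo hi σ β Pw U ≤ _
    rw [giF, mul_left_comm, ← wilsonWeight_mul_eq_union hdisj]
    exact mul_le_of_le_one_left bot_le (indicator_apply_le' (fun _ => le_rfl) fun _ => zero_le_one)
  · -- on the shell the box test passes: `wilsonU U < θ ≤ σ`
    show _ ≤ ENNReal.ofReal (Real.exp (-(β * ∑ p ∈ Pext, (1 - reTr (GaugeField.plaqHol U p))))) *
        giF lo hi σ β Pw U
    have hmem : U ∈ boxTest lo hi σ :=
      plaqSmallOn_mono_threshold hθσ (plaqSmallOn_anti hboxPu ((wilsonU_lt_iff hPu).1 hUθ))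
    rw [giF, indicator_of_mem hmem, Pi.one_apply, one_mul, wilsonWeight_mul_eq_union hdisj]

/-- **… FOR ANY PLAQUETTE SET SPLIT BY THE BLOCK**: with `P_all = P_ext ∪ P_w` (e.g. ALL plaquettes of the torus —
the level-0 `SU(N)` Gibbs measure `e^{−β S_W} dU`), the same conclusion for `e^{−β Σ_{p∈P_all}} dU`. [folklore] -/
theorem slotAntiConcentration_wilson_suN_gibbs_of_union
    {lo hi : Fin P.d → ℤ} {m : ℕ} (hN : ∀ κ, hi κ - lo κ < P.sitesPerDir j) (hm : ∀ κ, hi κ ≤ lo κ + m)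
    (Λ : Finset (PBond P j)) (hΛbox : ∀ b ∈ Λ, b ∈ boxBonds lo hi)
    (hΛcomb : Disjoint Λ (combBonds lo hi))
    (hcov : ∀ b ∈ boxBonds lo hi, b ∉ Λ → b ∈ (combBonds lo hi : Finset (PBond P j)))
    {S σ : ℝ} (hS : 0 ≤ S) (hS4 : S ≤ 1 / 4) (hσ : 0 < σ)
    (hN4 : (N : ℝ) * (((P.d - 1 : ℕ) : ℝ) * m * σ) < 4)
    (hrad : Real.sqrt N * (Real.pi / 2 * (((P.d - 1 : ℕ) : ℝ) * m * σ)) ≤ S)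
    {Pu : Finset (Plaq P j)} (hPu : Pu.Nonempty) (hPubox : ∀ p ∈ Pu, p ∈ boxPlaqs lo hi)
    (hboxPu : boxPlaqs lo hi ⊆ (↑Pu : Set (Plaq P j)))
    (Pw Pext Pall : Finset (Plaq P j)) {β θ δ ρ Rad : ℝ} (hβ : 0 ≤ β) (hθ : 0 < θ) (hθσ : θ ≤ σ) (hδ0 : 0 ≤ δ)
    (hδ1 : δ < 1) (hρ0 : 0 ≤ ρ) (hρ : ρ ≤ (1 - δ) / 2) (hRad : 1 < Rad)
    (hSM : 36 * (Real.exp (4 * S * Rad) - 1) / (Rad - 1) ^ 2 ≤ δ * θ)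
    (hSMσ : 4 * (4 * S) ^ 2 * Real.exp (2 * (4 * S)) ≤ δ * σ)
    (hPext : ∀ p ∈ Pext, (⟨p.src, p.μ⟩ : PBond P j) ∉ Λ ∧ (⟨p.src.shift p.μ, p.ν⟩ : PBond P j) ∉ Λ ∧
      (⟨p.src.shift p.ν, p.μ⟩ : PBond P j) ∉ Λ ∧ (⟨p.src, p.ν⟩ : PBond P j) ∉ Λ)
    (hdisj : Disjoint Pext Pw) (hall : Pext ∪ Pw = Pall) :
    SlotAntiConcentration
      ((fieldMeasure P j (SUN N)).withDensity fun U =>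
        ENNReal.ofReal (Real.exp (-(β * ∑ p ∈ Pall, (1 - reTr (GaugeField.plaqHol U p))))))
      (wilsonU hPu) θ ρ
      (2 * (((Λ.card * dimSU N : ℕ) : ℝ) + β * ∑ _p ∈ Pw, (4 * S) * (8 + 4 * (4 * S))) / (1 - δ)) := by
  rw [← hall]
  exact slotAntiConcentration_wilson_suN_gibbs hN hm Λ hΛbox hΛcomb hcov hS hS4 hσ hN4 hrad hPu hPubox hboxPu Pw Pext
    hβ hθ hθσ hδ0 hδ1 hρ0 hρ hRad hSM hSMσ hPext hdisj

end Gibbs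

/-! ## §2 END-I's one-run level-0 ledger of the `SU(N)` Gibbs measure: all cubes, (M1)₀ discharged -/

section Ledger

variable [DecidableEq (Plaq P j)] {σ₀ : Type*} [DecidableEq σ₀]

/-- **THE LEVEL-0 ONE-RUN LEDGER OF THE `SU(N)` GIBBS MEASURE ⇐ CLOSENESS + NUMERICS ONLY, EVERY `N`.**  ONE lattice
`(P, j)`; slots `s : σ₀` with per-slot box data (`lo s, hi s`, side bound `m s`, chart bonds `Λ s`, weight/exterior
plaquettes `Pw s`/`Pext s` splitting THE SAME `P_all`); the cubes present at cutoff `K` a finset `C K`; common numerics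
`S, σ, β, θ₀ = θ 0, δ, ρ₀ = ρ 0, Rad` as in §1; the positive integral of EVERY `(K, t)` is the Gibbs law
`μ = e^{−β Σ_{P_all}} dU` on `SU(N)^{bonds}`; run A's tested variable of slot `s` is `wilsonU (box s)`, run B's is any
measurable `u^B K t s` with the a.e. closeness `|wilsonU (box s) − u^B K t s| ≤ ρ₀θ₀`; `D_s ≤ D 0` uniformly.
CONCLUSION: `T4ShellMeasureLevels.LevelLedger l₀ (K ↦ (C K).powerset) A sh C piece 0 D ρ` for row S17's families
(`regionWeight`/`regionShell`/`regionPiece` of the cube partition against `μ`) — END-I's one-run ledger with the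
wall (M1)₀ DISCHARGED per slot by §1 (`T4ShellMeasureFibre.slotAntiConcentration_mono` to the uniform constant).
NOT NE7c; no window/count/rate; SU(2) the certified instance; nothing printed asserted. [folklore] -/
theorem levelLedger_wilson_suN_levelZero
    (lo hi : σ₀ → Fin P.d → ℤ) (m : σ₀ → ℕ) (hN : ∀ s κ, hi s κ - lo s κ < P.sitesPerDir j)
    (hm : ∀ s κ, hi s κ ≤ lo s κ + m s)
    (Λ : σ₀ → Finset (PBond P j)) (hΛbox : ∀ s, ∀ b ∈ Λ s, b ∈ boxBonds (lo s) (hi s))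
    (hΛcomb : ∀ s, Disjoint (Λ s) (combBonds (lo s) (hi s)))
    (hcov : ∀ s, ∀ b ∈ boxBonds (lo s) (hi s), b ∉ Λ s → b ∈ (combBonds (lo s) (hi s) : Finset (PBond P j)))
    {S σ : ℝ} (hS : 0 ≤ S) (hS4 : S ≤ 1 / 4) (hσ : 0 < σ)
    (hN4 : ∀ s, (N : ℝ) * (((P.d - 1 : ℕ) : ℝ) * m s * σ) < 4)
    (hrad : ∀ s, Real.sqrt N * (Real.pi / 2 * (((P.d - 1 : ℕ) : ℝ) * m s * σ)) ≤ S)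
    (Pu : σ₀ → Finset (Plaq P j)) (hPu : ∀ s, (Pu s).Nonempty) (hPubox : ∀ s, ∀ p ∈ Pu s, p ∈ boxPlaqs (lo s) (hi s))
    (hboxPu : ∀ s, boxPlaqs (lo s) (hi s) ⊆ (↑(Pu s) : Set (Plaq P j)))
    (Pw Pext : σ₀ → Finset (Plaq P j)) (Pall : Finset (Plaq P j)) {β δ Rad : ℝ} {θ ρ D : ℕ → ℝ} (hβ : 0 ≤ β)
    (hθ : 0 < θ 0) (hθσ : θ 0 ≤ σ) (hδ0 : 0 ≤ δ) (hδ1 : δ < 1) (hρ0 : ∀ i, 0 ≤ ρ i) (hρ : ρ 0 ≤ (1 - δ) / 2)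
    (hRad : 1 < Rad) (hSM : 36 * (Real.exp (4 * S * Rad) - 1) / (Rad - 1) ^ 2 ≤ δ * θ 0)
    (hSMσ : 4 * (4 * S) ^ 2 * Real.exp (2 * (4 * S)) ≤ δ * σ)
    (hPext : ∀ s, ∀ p ∈ Pext s, (⟨p.src, p.μ⟩ : PBond P j) ∉ Λ s ∧ (⟨p.src.shift p.μ, p.ν⟩ : PBond P j) ∉ Λ s ∧
      (⟨p.src.shift p.ν, p.μ⟩ : PBond P j) ∉ Λ s ∧ (⟨p.src, p.ν⟩ : PBond P j) ∉ Λ s)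
    (hdisj : ∀ s, Disjoint (Pext s) (Pw s)) (hall : ∀ s, Pext s ∪ Pw s = Pall)
    (hD0 : ∀ i, 0 ≤ D i)
    (hD : ∀ s, 2 * ((((Λ s).card * dimSU N : ℕ) : ℝ) + β * ∑ _p ∈ Pw s, (4 * S) * (8 + 4 * (4 * S))) / (1 - δ) ≤ D 0)
    -- the run's cubes per cutoff, the other run's tested variables, the closeness (node U1b at level 0)
    (C : ℕ → Finset σ₀) {l₀ : ℝ} (uB : ℕ → ℝ → σ₀ → GaugeField P j (SUN N) → ℝ) (huB : ∀ K t s, Measurable (uB K t s))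
    (hclose : ∀ K t, |t| ≤ l₀ → ∀ s ∈ C K,
      ∀ᵐ U ∂((fieldMeasure P j (SUN N)).withDensity fun U =>
        ENNReal.ofReal (Real.exp (-(β * ∑ p ∈ Pall, (1 - reTr (GaugeField.plaqHol U p)))))),
        |wilsonU (hPu s) U - uB K t s U| ≤ ρ 0 * θ 0) :
    LevelLedger l₀ (fun K => (C K).powerset)
      (fun K (_ : ℝ) => regionWeight (C K)
        ((fieldMeasure P j (SUN N)).withDensity fun U =>
          ENNReal.ofReal (Real.exp (-(β * ∑ p ∈ Pall, (1 - reTr (GaugeField.plaqHol U p))))))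
        (fun s => wilsonU (hPu s)) (θ 0))
      (fun K t => regionShell (C K)
        ((fieldMeasure P j (SUN N)).withDensity fun U =>
          ENNReal.ofReal (Real.exp (-(β * ∑ p ∈ Pall, (1 - reTr (GaugeField.plaqHol U p))))))
        (fun s => wilsonU (hPu s)) (uB K t) (θ 0))
      C
      (fun K t => regionPiece (C K)
        ((fieldMeasure P j (SUN N)).withDensity fun U =>
          ENNReal.ofReal (Real.exp (-(β * ∑ p ∈ Pall, (1 - reTr (GaugeField.plaqHol U p))))))
        (fun s => wilsonU (hPu s)) (uB K t) (θ 0))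
      (fun _ _ => 0) D ρ := by
  -- the Gibbs law is a finite measure (density ≤ 1 against the product Haar probability)
  haveI : IsFiniteMeasure ((fieldMeasure P j (SUN N)).withDensity fun U =>
      ENNReal.ofReal (Real.exp (-(β * ∑ p ∈ Pall, (1 - reTr (GaugeField.plaqHol U p)))))) := by
    refine isFiniteMeasure_withDensity ?_
    refine ne_top_of_le_ne_top (measure_ne_top (fieldMeasure P j (SUN N)) Set.univ) ?_
    calc ∫⁻ U, ENNReal.ofReal (Real.exp (-(β * ∑ p ∈ Pall, (1 - reTr (GaugeField.plaqHol U p)))))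
          ∂fieldMeasure P j (SUN N) ≤ ∫⁻ _U, 1 ∂fieldMeasure P j (SUN N) := lintegral_mono fun U => by
            rw [ENNReal.ofReal_le_one, Real.exp_le_one_iff, neg_nonpos]
            exact mul_nonneg hβ (wilsonSum_nonneg Pall U)
      _ = fieldMeasure P j (SUN N) Set.univ := lintegral_one
  -- (M1)₀ per slot, raised to the uniform constant `D 0`
  have hac : ∀ (K : ℕ) (t : ℝ), |t| ≤ l₀ → ∀ s ∈ C K, SlotAntiConcentration
      ((fieldMeasure P j (SUN N)).withDensity fun U =>
        ENNReal.ofReal (Real.exp (-(β * ∑ p ∈ Pall, (1 - reTr (GaugeField.plaqHol U p))))))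
      (wilsonU (hPu s)) (θ 0) (ρ 0) (D 0) := fun K t _ s _ =>
    T4ShellMeasureFibre.slotAntiConcentration_mono (hρ0 0) (hD s)
      (slotAntiConcentration_wilson_suN_gibbs_of_union (hN s) (hm s) (Λ s) (hΛbox s) (hΛcomb s) (hcov s) hS hS4 hσ
        (hN4 s) (hrad s) (hPu s) (hPubox s) (hboxPu s) (Pw s) (Pext s) Pall hβ hθ hθσ hδ0 hδ1 (hρ0 0) hρ hRad hSM
        hSMσ (hPext s) (hdisj s) (hall s))
  exact levelLedger_levelZero_cubes (μ := fun _ _ => (fieldMeasure P j (SUN N)).withDensity fun U =>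
      ENNReal.ofReal (Real.exp (-(β * ∑ p ∈ Pall, (1 - reTr (GaugeField.plaqHol U p))))))
    (uA := fun _ _ s => wilsonU (hPu s)) (fun _ _ s => measurable_wilsonU (hPu s)) huB hclose hD0 hρ0 hac

end Ledger

end Summit.QuantumFields.BalabanUV.T4Continuum.ShellMeasureWilsonLedgerSUN

end
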